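import Summits.CriticalPhenomena.PercolationContinuityZ3.Theorems.PercNearOneGluingNoHeavyConstsChainRuleLocalFamily
import Summits.CriticalPhenomena.PercolationContinuityZ3.Theorems.PercNearOneGluingNoHeavyConstsChainRulePendantVO
import Summits.CriticalPhenomena.PercolationContinuityZ3.Theorems.PercNearOneGluingNoHeavyConstsChainRuleChainMinor
import Summits.CriticalPhenomena.PercolationContinuityZ3.Theorems.PercNearOneGluingNoHeavyConstsDominatedChainRule
import Summits.CriticalPhenomena.PercolationContinuityZ3.Theorems.PercNearOneGluingNoHeavyLowerTailHullPortDeletedEdges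
import Literature.Probability.LatticeModels.StrongHarrisKleitman
import Literature.Probability.Percolation.TwoClusterGibbsCovariance
import Mathlib.LinearAlgebra.Matrix.Determinant.Basic
import HarnessLib
import HarnessLib.Audit.Tags

/-!
# THE LOCAL FAMILY: the single-edge chain rule for every avoided vertex attached only to the named points (THEOREM)
# (PAPER-2 track (ii): constants of the CSH family)

builds on p205010 (kernel theorem, internal audit signed; external expert review pending).  Support file (`--supports
stmt-CriticalPhenomena-4575`), seat `prim-consts-2` (gen 7); rows A6/A11 of `run/shared/lean/prim/consts/CONSTANTS.md`; memo
`run/shared/lean/prim/consts/FROM-prim-consts-2-g7-ROW-SPLIT.md` §11.  No definitions, no named facts, no sorries; standard axioms.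

Let `y` be the avoided vertex and suppose every pair `s(y,z)` with `z ∉ {x,u,v,o}` has weight `0` (`y` hangs off the named points only, with
arbitrary attachment weights `q_t = w(s(y,t))`, arbitrary graph elsewhere).  Peeling the four pairs at `y` (one-coordinate decomposition of the
product measure, `StrongHarris.real_eq_preimage_insert_add_preimage_sdiff`; an open pair `s(y,t)` turns "avoid `T ∋ y`" into "avoid `T ∪ {t}`",
`BHK2006.forall_not_reachable_insert_pair_iff`; deleted pairs = switched-off weights, `HullPort.measureReal_preimage_sdiff_prodBernoulli`)
expresses every kernel entry `K(S, T₀ ∪ {y})` through the kernel `k` of the weight vector switched off at `y`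
(`Consts.real_avoid_insert_peel`), and the chain minor of `Consts.singleEdgeChainRule_of_chainMinor` (p306944) at `Y = {y}` becomes the CLOSED FORM

  `D(G;{y}) = (1−q_x)³ (1−q_o) (1−q_v) · [ (1−q_u)³ ((1−q_v) D₀ + q_v L_D) + q_u (1−q_u)² ((1−q_v) A_D₀ + q_v · k(xuv,o) N₀) ]`

with the four 4-point polynomials `D₀` (`Consts.chainRule_voAvoid_noTarget`, p305568), `L_D` (`RR₂`, `Consts.disconnect_rr2`), `A_D₀`
(`Consts.chainMinor_uAvoid_noTarget`) and `N₀` (`Consts.avoid_mul_avoid_le_local`) (p308394), all nonnegative.  Hence: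

* `Consts.chainMinor_nonneg_local` — **THEOREM: `0 ≤ D(G;{y})`** for `x,u,v,o,y` pairwise distinct and `w(s(y,z)) = 0` off `{x,u,v,o}`;
* `Consts.chainRuleDet_mul_nonneg_local` — **the single-edge chain-rule minor `Δ` at `(x,u,v,o,{y})` satisfies `K(x,{y,o,v}) · Δ ≥ 0`**
  (`Consts.chainRuleDet_mul_nonneg_of_chainMinor_nonneg`): the chain rule holds for the whole LOCAL FAMILY (off the degenerate locus
  `K(x,{y,o,v}) = 0`), extending the pendant family of p305368/p305568 (one attachment) to simultaneous attachments with arbitrary weights.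
The identity is polynomial in the eight factors `q_t, 1 − q_t` taken as independent variables (this is how `ring` is kept small).
[cite: VandenbergHaggstromKahn2005, Thm. 1.1 (pp. 3–5), Thm. 1.3 (p. 6)] [cite: Grimmett1999, §1.3 p. 10, §2.2]
-/

noncomputable section

namespace Summit.CriticalPhenomena.PercolationContinuityZ3.Theorems

open MeasureTheory Set Literature.Probability.LatticeModels Literature.Probability.Percolation
open scoped Classical

namespace Consts

/-- Notation (this file only): the disconnection kernel `𝕂[w](S, T) = μ_w{S ↮ T}`. -/
local notation3 "𝕂[" w "](" S ", " T ")" =>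
  MeasureTheory.Measure.real (prodBernoulli w) {ω | ∀ s ∈ S, ∀ t ∈ T, ¬ (openGraph ω).Reachable s t}

/-- Notation (this file only): disconnection read in the configuration with the pairs `F` deleted,
`𝔸[w](F, S, T) = μ_w{S ↮ T in ω ∖ F}`. -/
local notation3 "𝔸[" w "](" F ", " S ", " T ")" =>
  MeasureTheory.Measure.real (prodBernoulli w) {ω : BondConfig _ | ∀ s ∈ S, ∀ t ∈ T, ¬ (openGraph (ω \ F)).Reachable s t}

variable {V : Type*}

section Helpers

/-- `𝔸[w](∅, S, T) = K(S,T)`. -/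
theorem avoidSdiff_empty (w : Sym2 V → unitInterval) (S T : Set V) : 𝔸[w]((∅ : Set (Sym2 V)), S, T) = 𝕂[w](S, T) := by
  simp only [Set.sdiff_empty]

/-- A source in the target kills the event. -/
theorem avoidSdiff_eq_zero_of_mem (w : Sym2 V → unitInterval) (F : Set (Sym2 V)) {S T : Set V} {a : V}
    (haS : a ∈ S) (haT : a ∈ T) : 𝔸[w](F, S, T) = 0 := by
  have : {ω : BondConfig V | ∀ s ∈ S, ∀ t ∈ T, ¬ (openGraph (ω \ F)).Reachable s t} = ∅ := by
    ext ω; simp only [mem_setOf_eq, mem_empty_iff_false, iff_false, not_forall, not_not]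
    exact ⟨a, haS, a, haT, SimpleGraph.Reachable.refl _⟩
  rw [this, measureReal_empty]

end Helpers

variable [Fintype V]

/-- **One-pair pivot for disconnection events.**  If `y ∈ T`, `y ≠ t` and the pair `e = s(y,t)` is not yet deleted, then
`μ{S ↮ T in ω∖F} = w(e)·μ{S ↮ T∪{t} in ω∖(F∪{e})} + (1 − w(e))·μ{S ↮ T in ω∖(F∪{e})}`
(condition on the state of `e`; with `e` open, avoiding `T ∋ y` means avoiding `T ∪ {t}` without `e`).
[cite: VandenbergHaggstromKahn2005, Thm. 1.1 proof (pp. 4–5), conditioning on the edges at the avoided set] -/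
theorem avoidSdiff_pivot (w : Sym2 V → unitInterval) (F : Set (Sym2 V)) (S T : Set V) {y t : V}
    (hy : y ∈ T) (hyt : y ≠ t) (he : s(y, t) ∉ F) :
    𝔸[w](F, S, T) = (w s(y, t) : ℝ) * 𝔸[w](insert s(y, t) F, S, insert t T) +
      (1 - (w s(y, t) : ℝ)) * 𝔸[w](insert s(y, t) F, S, T) := by
  classical
  have hXd : DeterminedBy {ω : BondConfig V | ∀ s ∈ S, ∀ t' ∈ T, ¬ (openGraph (ω \ F)).Reachable s t'}
      (↑(Finset.univ : Finset (Sym2 V)) : Set (Sym2 V)) := by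
    rw [Finset.coe_univ]; exact dependsOn_univ _
  have hpiv := StrongHarris.real_eq_preimage_insert_add_preimage_sdiff w (s(y, t)) hXd
  -- identify the two sections
  have h1 : insert s(y, t) ⁻¹' {ω : BondConfig V | ∀ s ∈ S, ∀ t' ∈ T, ¬ (openGraph (ω \ F)).Reachable s t'} =
      {ω : BondConfig V | ∀ s ∈ S, ∀ t' ∈ insert t T, ¬ (openGraph (ω \ insert s(y, t) F)).Reachable s t'} := by
    ext ω
    simp only [mem_preimage, mem_setOf_eq]
    have hcfg : insert s(y, t) ω \ F = insert s(y, t) (ω \ insert s(y, t) F) := by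
      ext f
      simp only [mem_sdiff, mem_insert_iff]
      constructor
      · rintro ⟨hf | hf, hfF⟩
        · exact Or.inl hf
        · by_cases hfe : f = s(y, t)
          · exact Or.inl hfe
          · exact Or.inr ⟨hf, fun h => h.elim hfe hfF⟩
      · rintro (hf | ⟨hf, hfn⟩)
        · refine ⟨Or.inl hf, fun hfF => he ?_⟩
          rw [← hf]; exact hfF
        · exact ⟨Or.inr hf, fun hfF => hfn (Or.inr hfF)⟩
    rw [hcfg]
    constructor
    · intro h s hs
      exact (BHK2006.forall_not_reachable_insert_pair_iff (ω \ insert s(y, t) F) T hy hyt s).1 (h s hs)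
    · intro h s hs
      exact (BHK2006.forall_not_reachable_insert_pair_iff (ω \ insert s(y, t) F) T hy hyt s).2 (h s hs)
  have h2 : (· \ {s(y, t)}) ⁻¹' {ω : BondConfig V | ∀ s ∈ S, ∀ t' ∈ T, ¬ (openGraph (ω \ F)).Reachable s t'} =
      {ω : BondConfig V | ∀ s ∈ S, ∀ t' ∈ T, ¬ (openGraph (ω \ insert s(y, t) F)).Reachable s t'} := by
    ext ω
    simp only [mem_preimage, mem_setOf_eq]
    have hcfg : ((ω \ ({s(y, t)} : Set (Sym2 V))) \ F : Set (Sym2 V)) = ω \ insert s(y, t) F := by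
      ext f; simp only [mem_sdiff, mem_singleton_iff, mem_insert_iff]; tauto
    rw [hcfg]
  rw [hpiv, h1, h2]

/-- **Deleted pairs = switched-off weights**: `μ_w{S ↮ T in ω∖F} = K_{w_F}(S,T)` with `w_F = w` off `F`, `0` on `F`.
[folklore] -/
theorem avoidSdiff_eq_kernel (w : Sym2 V → unitInterval) (F : Set (Sym2 V)) (S T : Set V) :
    𝔸[w](F, S, T) = 𝕂[fun e => if e ∈ F then 0 else w e](S, T) := by
  have h := HullPort.measureReal_preimage_sdiff_prodBernoulli w F
    {ω : BondConfig V | ∀ s ∈ S, ∀ t ∈ T, ¬ (openGraph ω).Reachable s t}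
  exact h

/-- **An almost surely isolated vertex may be dropped from the avoided set**: if every pair at `y` has weight `0` and `y ∉ S`,
then `K(S, T ∪ {y}) = K(S, T)`. [folklore] -/
theorem real_avoid_insert_of_isolated (p : Sym2 V → unitInterval) (S T : Set V) {y : V} (hyS : y ∉ S)
    (hp : ∀ z, z ≠ y → p s(y, z) = 0) :
    𝕂[p](S, insert y T) = 𝕂[p](S, T) := by
  classical
  set μ := prodBernoulli p with hμ
  have hmeas : ∀ A : Set (BondConfig V), MeasurableSet A := fun _ => MeasurableSet.of_discrete
  set A : Set (BondConfig V) := {ω | ∀ s ∈ S, ∀ t ∈ insert y T, ¬ (openGraph ω).Reachable s t} with hA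
  set B : Set (BondConfig V) := {ω | ∀ s ∈ S, ∀ t ∈ T, ¬ (openGraph ω).Reachable s t} with hB
  set Fy : Finset (Sym2 V) := (Finset.univ.erase y).image (fun z => s(y, z)) with hFy
  set N : Set (BondConfig V) := {ω | ∃ e ∈ Fy, e ∈ ω} with hN
  have hAB : A ⊆ B := fun ω h s hs t ht => h s hs t (mem_insert_of_mem _ ht)
  have hBA : B ⊆ A ∪ N := by
    intro ω hω
    by_cases hN' : ω ∈ N
    · exact Or.inr hN'
    · refine Or.inl fun s hs t ht => ?_
      rcases mem_insert_iff.1 ht with rfl | ht'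
      · -- `s ↮ y`: a path would end with an open pair at `y`
        intro hr
        have hsy : s ≠ t := fun h => hyS (h ▸ hs)
        obtain ⟨q⟩ := hr.symm
        cases q with
        | nil => exact hsy rfl
        | cons hadj q' =>
          rename_i z
          have hmem := (openGraph_adj ω t z).1 hadj
          apply hN'
          refine ⟨s(t, z), ?_, hmem.1⟩
          rw [hFy, Finset.mem_image]
          exact ⟨z, Finset.mem_erase.2 ⟨fun h => hmem.2 h.symm, Finset.mem_univ _⟩, rfl⟩
      · exact hω s hs t ht'
  have hN0 : μ.real N ≤ 0 := by
    have h := prodBernoulli_real_exists_mem_le_sum p Fy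
    have hsum : ∑ e ∈ Fy, (p e : ℝ) = 0 := by
      refine Finset.sum_eq_zero fun e he => ?_
      rw [hFy, Finset.mem_image] at he
      obtain ⟨z, hz, rfl⟩ := he
      have hzy : z ≠ y := (Finset.mem_erase.1 hz).1
      rw [hp z hzy]; rfl
    rw [hsum] at h; exact h
  have h1 : μ.real A ≤ μ.real B := measureReal_mono hAB
  have h2 : μ.real B ≤ μ.real A + μ.real N := (measureReal_mono hBA).trans (measureReal_union_le A N)
  have hNn : 0 ≤ μ.real N := measureReal_nonneg
  linarith


/-- The pivot with the avoided vertex `y` kept outermost: for `y ∉ T'`... (variant of `avoidSdiff_pivot`). -/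
theorem avoidSdiff_pivot' (w : Sym2 V → unitInterval) (F : Set (Sym2 V)) (S T : Set V) {y t : V}
    (hyt : y ≠ t) (he : s(y, t) ∉ F) :
    𝔸[w](F, S, insert y T) = (w s(y, t) : ℝ) * 𝔸[w](insert s(y, t) F, S, insert y (insert t T)) +
      (1 - (w s(y, t) : ℝ)) * 𝔸[w](insert s(y, t) F, S, insert y T) := by
  rw [avoidSdiff_pivot w F S (insert y T) (mem_insert y T) hyt he, Set.insert_comm t y T]

/-- **The peel of one entry.**  For an avoided vertex `y` whose pairs to vertices outside `{x,u,v,o}` have weight zero,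
`x ∈ S`, `y ∉ S`, `y ∉ T₀`: `K_w(S, T₀ ∪ {y})` expands over the states of the three pairs `yu, yv, yo` (the pair `yx` only
contributes the factor `1 − w(yx)` since `x ∈ S`), the kernel entries being those of the weight vector `w⁰ = w` switched off at the
four pairs. [cite: VandenbergHaggstromKahn2005, Thm. 1.1 proof (pp. 4–5)] -/
theorem real_avoid_insert_peel (w : Sym2 V → unitInterval) (x u v o y : V) (S T₀ : Set V)
    (hxS : x ∈ S) (hyS : y ∉ S)
    (hyx : y ≠ x) (hyu : y ≠ u) (hyv : y ≠ v) (hyo : y ≠ o) (hxu : x ≠ u) (hxv : x ≠ v) (hxo : x ≠ o) (huv : u ≠ v) (huo : u ≠ o)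
    (hvo : v ≠ o) (hloc : ∀ z, z ≠ x → z ≠ u → z ≠ v → z ≠ o → w s(y, z) = 0)
    (F : Set (Sym2 V)) (hF : F = insert s(y, o) (insert s(y, v) (insert s(y, u) (insert s(y, x) (∅ : Set (Sym2 V)))))) :
    𝕂[w](S, insert y T₀) =
      (1 - (w s(y, x) : ℝ)) *
        ((1 - (w s(y, u) : ℝ)) *
            ((1 - (w s(y, v) : ℝ)) *
                ((1 - (w s(y, o) : ℝ)) * 𝕂[fun e => if e ∈ F then 0 else w e](S, T₀) +
                  (w s(y, o) : ℝ) * 𝕂[fun e => if e ∈ F then 0 else w e](S, insert o T₀)) +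
              (w s(y, v) : ℝ) *
                ((1 - (w s(y, o) : ℝ)) * 𝕂[fun e => if e ∈ F then 0 else w e](S, insert v T₀) +
                  (w s(y, o) : ℝ) * 𝕂[fun e => if e ∈ F then 0 else w e](S, insert o (insert v T₀)))) +
          (w s(y, u) : ℝ) *
            ((1 - (w s(y, v) : ℝ)) *
                ((1 - (w s(y, o) : ℝ)) * 𝕂[fun e => if e ∈ F then 0 else w e](S, insert u T₀) +
                  (w s(y, o) : ℝ) * 𝕂[fun e => if e ∈ F then 0 else w e](S, insert o (insert u T₀))) +
              (w s(y, v) : ℝ) *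
                ((1 - (w s(y, o) : ℝ)) * 𝕂[fun e => if e ∈ F then 0 else w e](S, insert v (insert u T₀)) +
                  (w s(y, o) : ℝ) * 𝕂[fun e => if e ∈ F then 0 else w e](S, insert o (insert v (insert u T₀)))))) := by
  -- the deleted-pair sets
  set F₁ : Set (Sym2 V) := insert s(y, x) (∅ : Set (Sym2 V)) with hF₁
  set F₂ : Set (Sym2 V) := insert s(y, u) F₁ with hF₂
  set F₃ : Set (Sym2 V) := insert s(y, v) F₂ with hF₃
  have hne : ∀ a b : V, a ≠ b → s(y, a) ≠ s(y, b) := fun a b hab h => hab (Sym2.congr_right.1 h)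
  have he₁ : s(y, x) ∉ (∅ : Set (Sym2 V)) := fun h => h
  have he₂ : s(y, u) ∉ F₁ := by
    rw [hF₁]; simp only [mem_insert_iff, mem_empty_iff_false, or_false]; exact hne u x hxu.symm
  have he₃ : s(y, v) ∉ F₂ := by
    rw [hF₂, hF₁]; simp only [mem_insert_iff, mem_empty_iff_false, or_false, not_or]
    exact ⟨hne v u huv.symm, hne v x hxv.symm⟩
  have he₄ : s(y, o) ∉ F₃ := by
    rw [hF₃, hF₂, hF₁]; simp only [mem_insert_iff, mem_empty_iff_false, or_false, not_or]
    exact ⟨hne o v hvo.symm, hne o u huo.symm, hne o x hxo.symm⟩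
  -- the final kernel: all pairs at `y` are switched off
  have hzero : ∀ z, z ≠ y → (fun e : Sym2 V => if e ∈ F then (0 : unitInterval) else w e) s(y, z) = 0 := by
    intro z hzy
    show (if s(y, z) ∈ F then (0 : unitInterval) else w s(y, z)) = 0
    split_ifs with h
    · rfl
    · have hz : z ≠ x ∧ z ≠ u ∧ z ≠ v ∧ z ≠ o := by
        refine ⟨?_, ?_, ?_, ?_⟩ <;> rintro rfl <;> apply h <;> rw [hF] <;> simp [hF₃, hF₂, hF₁]
      exact hloc z hz.1 hz.2.1 hz.2.2.1 hz.2.2.2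
  have fin : ∀ T' : Set V, 𝔸[w](insert s(y, o) F₃, S, insert y T') = 𝕂[fun e : Sym2 V => if e ∈ F then (0 : unitInterval) else w e](S, T') := by
    intro T'
    rw [avoidSdiff_eq_kernel, ← hF]
    exact real_avoid_insert_of_isolated (fun e : Sym2 V => if e ∈ F then (0 : unitInterval) else w e) S T' hyS hzero
  -- pivot `x` (the first branch vanishes since `x ∈ S`)
  rw [← avoidSdiff_empty w S (insert y T₀), avoidSdiff_pivot' w ∅ S T₀ hyx he₁,
    avoidSdiff_eq_zero_of_mem w F₁ hxS (mem_insert_of_mem y (mem_insert x T₀)), mul_zero, zero_add]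
  -- pivot `u`, then `v`, then `o`
  rw [avoidSdiff_pivot' w F₁ S T₀ hyu he₂]
  rw [avoidSdiff_pivot' w F₂ S T₀ hyv he₃, avoidSdiff_pivot' w F₂ S (insert u T₀) hyv he₃]
  rw [avoidSdiff_pivot' w F₃ S T₀ hyo he₄, avoidSdiff_pivot' w F₃ S (insert v T₀) hyo he₄,
    avoidSdiff_pivot' w F₃ S (insert u T₀) hyo he₄, avoidSdiff_pivot' w F₃ S (insert v (insert u T₀)) hyo he₄]
  simp only [fin]
  ring

/-- **THE LOCAL FAMILY: the chain minor is nonnegative for an avoided vertex attached only to `x, u, v, o`.** -/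
theorem chainMinor_nonneg_local (w : Sym2 V → unitInterval) (x u v o y : V)
    (hyx : y ≠ x) (hyu : y ≠ u) (hyv : y ≠ v) (hyo : y ≠ o) (hxu : x ≠ u) (hxv : x ≠ v) (hxo : x ≠ o) (huv : u ≠ v) (huo : u ≠ o)
    (hvo : v ≠ o) (hloc : ∀ z, z ≠ x → z ≠ u → z ≠ v → z ≠ o → w s(y, z) = 0) :
    0 ≤ Matrix.det !![
      𝕂[w](({x} : Set V), ({y} : Set V)), 𝕂[w](({x} : Set V), insert o ({y} : Set V)), 𝕂[w](({x} : Set V), insert v (insert o ({y} : Set V)));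
      𝕂[w](({x, u} : Set V), ({y} : Set V)), 𝕂[w](({x, u} : Set V), insert o ({y} : Set V)), 𝕂[w](({x, u} : Set V), insert v (insert o ({y} : Set V)));
      𝕂[w](({x, u, v} : Set V), ({y} : Set V)), 𝕂[w](({x, u, v} : Set V), insert o ({y} : Set V)),
        𝕂[w](({x, u, v} : Set V), insert v (insert o ({y} : Set V)))] := by
  -- normalise the targets to `insert y T₀`
  have h3 : (insert v (insert o ({y} : Set V)) : Set V) = insert y (insert v ({o} : Set V)) := by
    ext a; simp only [mem_insert_iff, mem_singleton_iff]; tauto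
  have h2 : (insert o ({y} : Set V) : Set V) = insert y ({o} : Set V) := Set.pair_comm _ _
  have h1 : ({y} : Set V) = insert y (∅ : Set V) := Set.singleton_def y
  rw [h3, h2, h1]
  -- the switched-off weight vector
  obtain ⟨F, hF⟩ : ∃ F : Set (Sym2 V), F = insert s(y, o) (insert s(y, v) (insert s(y, u) (insert s(y, x) (∅ : Set (Sym2 V))))) :=
    ⟨_, rfl⟩
  have hx1 : x ∈ ({x} : Set V) := rfl
  have hx2 : x ∈ ({x, u} : Set V) := mem_insert _ _
  have hx3 : x ∈ ({x, u, v} : Set V) := mem_insert _ _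
  have hy1 : y ∉ ({x} : Set V) := fun h => hyx (mem_singleton_iff.1 h)
  have hy2 : y ∉ ({x, u} : Set V) := by simp only [mem_insert_iff, mem_singleton_iff, not_or]; exact ⟨hyx, hyu⟩
  have hy3 : y ∉ ({x, u, v} : Set V) := by simp only [mem_insert_iff, mem_singleton_iff, not_or]; exact ⟨hyx, hyu, hyv⟩
  have P := fun (S : Set V) (hxS : x ∈ S) (hyS : y ∉ S) (T₀ : Set V) =>
    real_avoid_insert_peel w x u v o y S T₀ hxS hyS hyx hyu hyv hyo hxu hxv hxo huv huo hvo hloc F hF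
  rw [Matrix.det_fin_three]
  simp only [Matrix.of_apply, Matrix.cons_val', Matrix.cons_val_zero, Matrix.cons_val_one, Matrix.cons_val_two,
    Matrix.empty_val', Matrix.cons_val_fin_one, Matrix.head_cons, Matrix.tail_cons, Matrix.head_fin_const]
  rw [P _ hx1 hy1 ∅, P _ hx1 hy1 {o}, P _ hx1 hy1 (insert v {o}), P _ hx2 hy2 ∅, P _ hx2 hy2 {o}, P _ hx2 hy2 (insert v {o}),
    P _ hx3 hy3 ∅, P _ hx3 hy3 {o}, P _ hx3 hy3 (insert v {o})]
  -- the switched-off weight vector, its kernel entries that vanish, and set normalisations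
  set wF : Sym2 V → unitInterval := fun e => if e ∈ F then 0 else w e with hwF
  have z0 : 𝕂[wF](({x, u} : Set V), ({u} : Set V)) = 0 := real_avoid_eq_zero_of_mem wF (mem_insert_of_mem _ (mem_singleton u)) (mem_singleton u)
  have z1 : 𝕂[wF](({x, u} : Set V), ({u, o} : Set V)) = 0 := real_avoid_eq_zero_of_mem wF (mem_insert_of_mem _ (mem_singleton u)) (mem_insert u _)
  have z2 : 𝕂[wF](({x, u} : Set V), ({u, v} : Set V)) = 0 := real_avoid_eq_zero_of_mem wF (mem_insert_of_mem _ (mem_singleton u)) (mem_insert u _)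
  have z3 : 𝕂[wF](({x, u} : Set V), ({u, v, o} : Set V)) = 0 := real_avoid_eq_zero_of_mem wF (mem_insert_of_mem _ (mem_singleton u)) (mem_insert u _)
  have z4 : 𝕂[wF](({x, u, v} : Set V), ({v} : Set V)) = 0 := real_avoid_eq_zero_of_mem wF (mem_insert_of_mem _ (mem_insert_of_mem _ (mem_singleton v))) (mem_singleton v)
  have z5 : 𝕂[wF](({x, u, v} : Set V), ({v, o} : Set V)) = 0 := real_avoid_eq_zero_of_mem wF (mem_insert_of_mem _ (mem_insert_of_mem _ (mem_singleton v))) (mem_insert v _)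
  have z6 : 𝕂[wF](({x, u, v} : Set V), ({u} : Set V)) = 0 := real_avoid_eq_zero_of_mem wF (mem_insert_of_mem _ (mem_insert u _)) (mem_singleton u)
  have z7 : 𝕂[wF](({x, u, v} : Set V), ({u, o} : Set V)) = 0 := real_avoid_eq_zero_of_mem wF (mem_insert_of_mem _ (mem_insert u _)) (mem_insert u _)
  have z8 : 𝕂[wF](({x, u, v} : Set V), ({u, v} : Set V)) = 0 := real_avoid_eq_zero_of_mem wF (mem_insert_of_mem _ (mem_insert u _)) (mem_insert u _)
  have z9 : 𝕂[wF](({x, u, v} : Set V), ({u, v, o} : Set V)) = 0 := real_avoid_eq_zero_of_mem wF (mem_insert_of_mem _ (mem_insert u _)) (mem_insert u _)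
  have one0 : 𝕂[wF](({x} : Set V), (∅ : Set V)) = 1 := real_avoid_emptyTarget wF _
  have one1 : 𝕂[wF](({x, u} : Set V), (∅ : Set V)) = 1 := real_avoid_emptyTarget wF _
  have one2 : 𝕂[wF](({x, u, v} : Set V), (∅ : Set V)) = 1 := real_avoid_emptyTarget wF _
  have c1 : insert o ({o} : Set V) = {o} := Set.insert_eq_of_mem (mem_singleton o)
  have c2 : insert o ({v, o} : Set V) = {v, o} := Set.insert_eq_of_mem (mem_insert_of_mem _ (mem_singleton o))
  have c3 : insert o ({u, o} : Set V) = {u, o} := Set.insert_eq_of_mem (mem_insert_of_mem _ (mem_singleton o))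
  have c5 : insert o ({u, v, o} : Set V) = {u, v, o} := Set.insert_eq_of_mem (mem_insert_of_mem _ (mem_insert_of_mem _ (mem_singleton o)))
  have c6 : insert v ({u, v, o} : Set V) = {u, v, o} := Set.insert_eq_of_mem (mem_insert_of_mem _ (mem_insert v _))
  have c7 : insert v ({v, o} : Set V) = {v, o} := Set.insert_eq_of_mem (mem_insert v _)
  have e_ov : ({o, v} : Set V) = {v, o} := Set.pair_comm o v
  have e_ou : ({o, u} : Set V) = {u, o} := Set.pair_comm o u
  have e_vu : ({v, u} : Set V) = {u, v} := Set.pair_comm v u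
  have e_vuo : ({v, u, o} : Set V) = {u, v, o} := by
    ext a; simp only [mem_insert_iff, mem_singleton_iff]; tauto
  have e_ouv : ({o, u, v} : Set V) = {u, v, o} := by
    ext a; simp only [mem_insert_iff, mem_singleton_iff]; tauto
  have hco : ∀ a : ℝ, (1 - (w s(y, o) : ℝ)) * a + (w s(y, o) : ℝ) * a = a := fun a => by ring
  have hcv : ∀ a : ℝ, (1 - (w s(y, v) : ℝ)) * a + (w s(y, v) : ℝ) * a = a := fun a => by ring
  simp only [← Set.singleton_def, c1, c2, c3, c5, c6, c7, e_ov, e_ou, e_vu, e_vuo, e_ouv,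
    z0, z1, z2, z3, z4, z5, z6, z7, z8, z9, one0, one1, one2, mul_one, mul_zero, add_zero, hco, hcv]
  -- the four 4-point inequalities for the switched-off weights
  have hq : ∀ e : Sym2 V, 0 ≤ (w e : ℝ) ∧ (w e : ℝ) ≤ 1 := fun e => ⟨(w e).2.1, (w e).2.2⟩
  have hD0 := chainRule_voAvoid_noTarget wF x u v o
  rw [Matrix.det_fin_three] at hD0
  simp only [Matrix.of_apply, Matrix.cons_val', Matrix.cons_val_zero, Matrix.cons_val_one, Matrix.cons_val_two,
    Matrix.empty_val', Matrix.cons_val_fin_one, Matrix.head_cons, Matrix.tail_cons, Matrix.head_fin_const, z5, one0, one1, one2] at hD0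
  have hD0p : 0 ≤ (𝕂[wF](({x} : Set V), ({o} : Set V)) * 𝕂[wF](({x, u} : Set V), ({v, o} : Set V)) - 𝕂[wF](({x} : Set V), ({v, o} : Set V)) * 𝕂[wF](({x, u} : Set V), ({o} : Set V)) + 𝕂[wF](({x} : Set V), ({v, o} : Set V)) * 𝕂[wF](({x, u, v} : Set V), ({o} : Set V)) - 𝕂[wF](({x, u} : Set V), ({v, o} : Set V)) * 𝕂[wF](({x, u, v} : Set V), ({o} : Set V))) := by linarith [hD0]
  have hrr := disconnect_rr2 wF (show ({x} : Set V) ⊆ ({x, u} : Set V) from singleton_subset_iff.2 (mem_insert _ _))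
    (show ({v} : Set V) ⊆ ({v, o} : Set V) from singleton_subset_iff.2 (mem_insert _ _))
  have hLp : 0 ≤ (𝕂[wF](({x, u, v} : Set V), ({o} : Set V)) * (𝕂[wF](({x} : Set V), ({v, o} : Set V)) * 𝕂[wF](({x, u} : Set V), ({v} : Set V)) - 𝕂[wF](({x} : Set V), ({v} : Set V)) * 𝕂[wF](({x, u} : Set V), ({v, o} : Set V)))) := mul_nonneg measureReal_nonneg (by linarith [hrr])
  have hA := chainMinor_uAvoid_noTarget wF x u v o
  rw [Matrix.det_fin_three] at hA
  simp only [Matrix.of_apply, Matrix.cons_val', Matrix.cons_val_zero, Matrix.cons_val_one, Matrix.cons_val_two,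
    Matrix.empty_val', Matrix.cons_val_fin_one, Matrix.head_cons, Matrix.tail_cons, Matrix.head_fin_const, z5, one1, one2] at hA
  have hAp : 0 ≤ (-(𝕂[wF](({x} : Set V), ({u} : Set V)) * 𝕂[wF](({x, u} : Set V), ({v, o} : Set V)) * 𝕂[wF](({x, u, v} : Set V), ({o} : Set V))) + 𝕂[wF](({x} : Set V), ({u, o} : Set V)) * 𝕂[wF](({x, u} : Set V), ({v, o} : Set V)) - 𝕂[wF](({x} : Set V), ({u, v, o} : Set V)) * 𝕂[wF](({x, u} : Set V), ({o} : Set V)) + 𝕂[wF](({x} : Set V), ({u, v, o} : Set V)) * 𝕂[wF](({x, u, v} : Set V), ({o} : Set V))) := by linarith [hA]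
  have hN := avoid_mul_avoid_le_local wF x u v o
  rw [e_ov, e_ouv] at hN
  have hNp : 0 ≤ (𝕂[wF](({x, u, v} : Set V), ({o} : Set V)) * (𝕂[wF](({x} : Set V), ({u, v, o} : Set V)) * 𝕂[wF](({x, u} : Set V), ({v} : Set V)) - 𝕂[wF](({x} : Set V), ({u, v} : Set V)) * 𝕂[wF](({x, u} : Set V), ({v, o} : Set V)))) := mul_nonneg measureReal_nonneg (by linarith [hN])
  -- abstract the eight attachment factors (the identity below is polynomial in them)
  have h1x : 0 ≤ 1 - (w s(y, x) : ℝ) := by linarith [(hq s(y, x)).2]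
  have h1u : 0 ≤ 1 - (w s(y, u) : ℝ) := by linarith [(hq s(y, u)).2]
  have h1v : 0 ≤ 1 - (w s(y, v) : ℝ) := by linarith [(hq s(y, v)).2]
  have h1o : 0 ≤ 1 - (w s(y, o) : ℝ) := by linarith [(hq s(y, o)).2]
  have hqu := (hq s(y, u)).1
  have hqv := (hq s(y, v)).1
  generalize 1 - (w s(y, x) : ℝ) = px at h1x ⊢
  generalize 1 - (w s(y, u) : ℝ) = pu at h1u ⊢
  generalize 1 - (w s(y, v) : ℝ) = pv at h1v ⊢
  generalize 1 - (w s(y, o) : ℝ) = po at h1o ⊢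
  generalize (w s(y, x) : ℝ) = qx at *
  generalize (w s(y, u) : ℝ) = qu at hqu ⊢
  generalize (w s(y, v) : ℝ) = qv at hqv ⊢
  generalize (w s(y, o) : ℝ) = qo at *
  have hCF : 0 ≤ px ^ 3 * po * pv * (pu ^ 3 * (pv * (𝕂[wF](({x} : Set V), ({o} : Set V)) * 𝕂[wF](({x, u} : Set V), ({v, o} : Set V)) - 𝕂[wF](({x} : Set V), ({v, o} : Set V)) * 𝕂[wF](({x, u} : Set V), ({o} : Set V)) + 𝕂[wF](({x} : Set V), ({v, o} : Set V)) * 𝕂[wF](({x, u, v} : Set V), ({o} : Set V)) - 𝕂[wF](({x, u} : Set V), ({v, o} : Set V)) * 𝕂[wF](({x, u, v} : Set V), ({o} : Set V))) + qv * (𝕂[wF](({x, u, v} : Set V), ({o} : Set V)) * (𝕂[wF](({x} : Set V), ({v, o} : Set V)) * 𝕂[wF](({x, u} : Set V), ({v} : Set V)) - 𝕂[wF](({x} : Set V), ({v} : Set V)) * 𝕂[wF](({x, u} : Set V), ({v, o} : Set V))))) + qu * pu ^ 2 * (pv * (-(𝕂[wF](({x} : Set V), ({u} : Set V)) * 𝕂[wF](({x,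 u} : Set V), ({v, o} : Set V)) * 𝕂[wF](({x, u, v} : Set V), ({o} : Set V))) + 𝕂[wF](({x} : Set V), ({u, o} : Set V)) * 𝕂[wF](({x, u} : Set V), ({v, o} : Set V)) - 𝕂[wF](({x} : Set V), ({u, v, o} : Set V)) * 𝕂[wF](({x, u} : Set V), ({o} : Set V)) + 𝕂[wF](({x} : Set V), ({u, v, o} : Set V)) * 𝕂[wF](({x, u, v} : Set V), ({o} : Set V))) + qv * (𝕂[wF](({x, u, v} : Set V), ({o} : Set V)) * (𝕂[wF](({x} : Set V), ({u, v, o} : Set V)) * 𝕂[wF](({x, u} : Set V), ({v} : Set V)) - 𝕂[wF](({x} : Set V), ({u, v} : Set V)) * 𝕂[wF](({x, u} : Set V), ({v, o} : Set V)))))) :=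
    mul_nonneg (mul_nonneg (mul_nonneg (pow_nonneg h1x 3) h1o) h1v)
      (add_nonneg (mul_nonneg (pow_nonneg h1u 3) (add_nonneg (mul_nonneg h1v hD0p) (mul_nonneg hqv hLp)))
        (mul_nonneg (mul_nonneg hqu (pow_nonneg h1u 2)) (add_nonneg (mul_nonneg h1v hAp) (mul_nonneg hqv hNp))))
  -- the determinant IS the closed form
  have key : ∀ Dv : ℝ, Dv = px ^ 3 * po * pv * (pu ^ 3 * (pv * (𝕂[wF](({x} : Set V), ({o} : Set V)) * 𝕂[wF](({x, u} : Set V), ({v, o} : Set V)) - 𝕂[wF](({x} : Set V), ({v, o} : Set V)) * 𝕂[wF](({x, u} : Set V), ({o} : Set V)) + 𝕂[wF](({x} : Set V), ({v, o} : Set V)) * 𝕂[wF](({x, u, v} : Set V), ({o} : Set V)) - 𝕂[wF](({x, u} : Set V), ({v, o} : Set V)) * 𝕂[wF](({x, u, v} : Set V), ({o} : Set V))) + qv * (𝕂[wF](({x, u, v} : Set V), ({o} : Set V)) * (𝕂[wF](({x} : Set V), ({v, o} : Set V)) * 𝕂[wF](({x, u} : Set V), ({v} : Set V)) - 𝕂[wF](({x}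 : Set V), ({v} : Set V)) * 𝕂[wF](({x, u} : Set V), ({v, o} : Set V))))) + qu * pu ^ 2 * (pv * (-(𝕂[wF](({x} : Set V), ({u} : Set V)) * 𝕂[wF](({x, u} : Set V), ({v, o} : Set V)) * 𝕂[wF](({x, u, v} : Set V), ({o} : Set V))) + 𝕂[wF](({x} : Set V), ({u, o} : Set V)) * 𝕂[wF](({x, u} : Set V), ({v, o} : Set V)) - 𝕂[wF](({x} : Set V), ({u, v, o} : Set V)) * 𝕂[wF](({x, u} : Set V), ({o} : Set V)) + 𝕂[wF](({x} : Set V), ({u, v, o} : Set V)) * 𝕂[wF](({x, u, v} : Set V), ({o} : Set V))) + qv * (𝕂[wF](({x, u, v} : Set V), ({o} : Set V)) * (𝕂[wF](({x} : Set V), ({u, v, o} : Set V)) * 𝕂[wF](({x, u} : Set V), ({v} : Set V)) - 𝕂[wF](({x} : Set V), ({u, v} : Set V)) * 𝕂[wF](({x, u} : Set V), ({v, o} : Set V)))))) → 0 ≤ Dv := fun Dv h => h ▸ hCF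
  apply key
  ring

/-- **COROLLARY — the single-edge chain rule for the local family.**  Under the hypotheses of `Consts.chainMinor_nonneg_local`,
`0 ≤ K(x, {y} ∪ {o, v}) · Δ`, `Δ` the chain-rule minor of `Consts.SingleEdgeChainRule` at `(x, u, v, o, {y})`
(`Consts.chainRuleDet_mul_nonneg_of_chainMinor_nonneg`). [cite: VandenbergHaggstromKahn2005, Thm. 1.1 (pp. 3–5)] -/
theorem chainRuleDet_mul_nonneg_local (w : Sym2 V → unitInterval) (x u v o y : V)
    (hyx : y ≠ x) (hyu : y ≠ u) (hyv : y ≠ v) (hyo : y ≠ o) (hxu : x ≠ u) (hxv : x ≠ v) (hxo : x ≠ o) (huv : u ≠ v) (huo : u ≠ o)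
    (hvo : v ≠ o) (hloc : ∀ z, z ≠ x → z ≠ u → z ≠ v → z ≠ o → w s(y, z) = 0) :
    0 ≤ 𝕂[w](({x} : Set V), insert v (insert o ({y} : Set V))) * Matrix.det !![
      𝕂[w](({x} : Set V), insert v ({y} : Set V)), 𝕂[w](({x} : Set V), ({y} : Set V)), 𝕂[w](({x} : Set V), insert o ({y} : Set V));
      𝕂[w](({x, u} : Set V), insert v ({y} : Set V)), 𝕂[w](({x, u} : Set V), ({y} : Set V)), 𝕂[w](({x, u} : Set V), insert o ({y} : Set V));
      𝕂[w](({x, u, v} : Set V), insert v ({y} : Set V)), 𝕂[w](({x, u, v} : Set V), ({y} : Set V)),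
        𝕂[w](({x, u, v} : Set V), insert o ({y} : Set V))] :=
  chainRuleDet_mul_nonneg_of_chainMinor_nonneg w x u v o ({y} : Set V)
    (chainMinor_nonneg_local w x u v o y hyx hyu hyv hyo hxu hxv hxo huv huo hvo hloc)

end Consts

end Summit.CriticalPhenomena.PercolationContinuityZ3.Theorems

end
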